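import Summits.ValiantsHypothesis.ValiantsHypothesis.Theses.DecompCycle1C
import Literature.Computability.AlgebraicComplexity.BLMW11PermanentApproximationEquivalence
import HarnessLib

/-!
# Route `DecompCycle1C` — the collapse piece `CollapseToBorderDet` is a BARE RESIDUAL (kernel certificate)

Census instrument of the decomp-valiant workshop (seat `decomp-val-census-1`, generation 18), supporting the
crux item `CollapseToBorderDet` (stmt-ValiantsHypothesis-23564) of `Theses/DecompCycle1C.lean` WITHOUT closing
it: it certifies the census classification «BARE·THEOREM» of `census/BARE-LOCATOR-v1` (the critic's standing
BARE-RESIDUAL TEST, bus 668, after `Theorems/BareResidualCriterion.lean`).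

`CollapseToBorderDet` says: if `VP_ℂ = VNP_ℂ` then every `VNP` family lies in the closure `\overline{VP_ws}`
(`IsVPwsBarFamily`).  By the VNP-completeness step of [BLMW 2011, Prop. 9.3.2] — in the tree as the
unconditional `isVPwsBarFamily_perPoly_iff_vnp_subset_vpwsBar` (`\overline{VP_ws}` is closed under
p-projections, `IsVPwsBarFamily.of_isPProjection`) — the class-form consequent is equivalent to the
single-family statement `(per_m) ∈ \overline{VP_ws}`, and contraposition then shows that the piece is
LITERALLY the implication «`(per_m) ∉ \overline{VP_ws}` ⟹ `VP_ℂ ≠ VNP_ℂ`», i.e. the bridge from the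
polynomial-range Mulmuley–Sohoni border conjecture (`BorderDcPerSuperpolynomial`, BLMW Conj. 1.1; route
`WsBorderSandwich`'s piece `PerNotInVPwsBar` has the same body) to the summit.  Nothing here proves either
side; `VP ≠ VNP` is untouched (LADDER-Valiant rung 0).

* `collapseToBorderDet_iff_perMem`   : `CollapseToBorderDet ↔ (VP_ℂ = VNP_ℂ → (per_m) ∈ \overline{VP_ws})`;
* `collapseToBorderDet_iff_residual` : `CollapseToBorderDet ↔ ((per_m) ∉ \overline{VP_ws} → ValiantsHypothesis)`;
* `collapseToBorderDet_iff_borderDc` : `CollapseToBorderDet ↔ (BorderDcPerSuperpolynomial → ValiantsHypothesis)`;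
* `collapseToBorderDet_of_vh`         : the piece is implied by the summit (vacuous under `S`).

References: [BurgisserEtAl2011] P. Bürgisser, J.M. Landsberg, L. Manivel, J. Weyman, *An overview of
mathematical issues arising in the geometric complexity theory approach to VP ≠ VNP*, SIAM J. Comput. 40
(2011), Prop. 9.3.2, Conj. 1.1.
-/

-- layout Summits/ValiantsHypothesis/ValiantsHypothesis forces the duplicated namespace component
set_option linter.dupNamespace false

namespace Summit.ValiantsHypothesis.ValiantsHypothesis.Theorems.DecompCycle1CCollapseToBorderDetBare

open Literature.Computability.AlgebraicComplexity
open Summit.ValiantsHypothesis.ValiantsHypothesis.Theses.DecompCycle1C (CollapseToBorderDet)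

/-- **Single-family form.** Under the collapse hypothesis, «every `VNP` family is in `\overline{VP_ws}`» is
equivalent to «the permanent family is in `\overline{VP_ws}`» (BLMW 2011, Prop. 9.3.2, second equivalence:
VNP-completeness of `per` plus closure of `\overline{VP_ws}` under p-projections; tree
`isVPwsBarFamily_perPoly_iff_vnp_subset_vpwsBar`). [cite: BurgisserEtAl2011, Prop. 9.3.2] -/
theorem collapseToBorderDet_iff_perMem :
    CollapseToBorderDet ↔ (VP ℂ = VNP ℂ → IsVPwsBarFamily (fun m => perPoly (Fin m) ℂ)) := by
  unfold CollapseToBorderDet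
  constructor
  · intro h hEq
    exact isVPwsBarFamily_perPoly_of_vnp_subset_vpwsBar (h hEq)
  · intro h hEq v f hf
    exact vnp_subset_vpwsBar_of_isVPwsBarFamily_perPoly (h hEq) v f hf

/-- **`CollapseToBorderDet` is the bare residual of `(per_m) ∉ \overline{VP_ws}`**: the route's collapse
piece is equivalent to the implication «`(per_m) ∉ \overline{VP_ws}` ⟹ `ValiantsHypothesis`» (contraposition
of the single-family form; the census BARE-RESIDUAL TEST instance for item 23564).
[cite: BurgisserEtAl2011, Prop. 9.3.2] -/
theorem collapseToBorderDet_iff_residual :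
    CollapseToBorderDet ↔
      (¬ IsVPwsBarFamily (fun m => perPoly (Fin m) ℂ) → _root_.ValiantsHypothesis) := by
  rw [collapseToBorderDet_iff_perMem]
  change _ ↔ (¬ IsVPwsBarFamily (fun m => perPoly (Fin m) ℂ) → VP ℂ ≠ VNP ℂ)
  constructor
  · intro h hper hEq
    exact hper (h hEq)
  · intro h hEq
    by_contra hper
    exact h hper hEq

/-- **Mulmuley–Sohoni form**: `CollapseToBorderDet ↔ (BorderDcPerSuperpolynomial → ValiantsHypothesis)` — the
piece is exactly the bridge from the polynomial-range border-determinantal conjecture for the permanent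
(BLMW 2011, Conj. 1.1; tree `borderDcPerSuperpolynomial_iff_not_isVPwsBarFamily_perPoly`, Prop. 9.3.2 first
equivalence) to the summit. [cite: BurgisserEtAl2011, Conj. 1.1, Prop. 9.3.2] -/
theorem collapseToBorderDet_iff_borderDc :
    CollapseToBorderDet ↔ (BorderDcPerSuperpolynomial → _root_.ValiantsHypothesis) := by
  rw [collapseToBorderDet_iff_residual, borderDcPerSuperpolynomial_iff_not_isVPwsBarFamily_perPoly]

/-- **Necessity (vacuity under the summit)**: `ValiantsHypothesis → CollapseToBorderDet`. [folklore] -/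
theorem collapseToBorderDet_of_vh (h : _root_.ValiantsHypothesis) : CollapseToBorderDet :=
  collapseToBorderDet_iff_residual.2 fun _ => h

end Summit.ValiantsHypothesis.ValiantsHypothesis.Theorems.DecompCycle1CCollapseToBorderDetBare
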